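import Literature.Analysis.FluidPDE.HardSphereFlowRestart
import HarnessLib

/-!
# Scaling symmetry of the Euclidean collision-by-collision hard-sphere flow

First layer of the transfer proof of **Alexander's theorem in `ℝ^d`**
(`Literature.Analysis.FluidPDE.HardSphereFlow.nonempty`, discharged in
`Literature.Analysis.FluidPDE.HardSphereEuclideanAlexander` from the torus theorem of
`HardSphereAlexander` through the map `z ↦ P (L⁻¹ z)`: rescale, then project to `T^d`). This
file is the rescaling half, an *exact* symmetry of the construction of
`HardSphereFlowConstruction` in the Euclidean geometry: under `z ↦ c z` (positions AND velocities
multiplied by `c > 0`, time unchanged) the hard-sphere dynamics of diameter `ε` becomes the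
hard-sphere dynamics of diameter `cε` — free flight is linear, the separation vector scales, the
reflection law is linear in the velocities and only depends on the line of the impact direction
(`reflectVel_smul`), so exit times, incoming pairs, collision steps, states, instants, counts,
the forward / left-continuous / two-sided flows, simple incoming configurations, (truncated)
forward regularity and the good set all correspond (`Alexander.flow_smul`:
`T^t_{cε}(c z) = c T^t_ε(z)`; `Alexander.smul_mem_good_iff`: `c z ∈ Γ₀(cε) ↔ z ∈ Γ₀(ε)`). This is
the dimensional-analysis remark that only `ε / (length scale)` matters (GST 2013 Ch. 4 intro,
CIP 1994 §4.2); it lets the transfer to the unit torus use an arbitrarily large box of `ℝ^d`.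

* `Alexander.dite_nonempty_some_congr` — the pair selection `Set.Nonempty.some` of
  `collisionStep` only depends on the set of incoming pairs (used here and for the projection).
* `reflectVel_smul_pair`, `Alexander.freeFlight_smul`, `flipVel_smul`, `sepVec_smul`,
  `smul_mem_hardSphereDomain_iff`, `smul_mem_contactSet_iff`, `isIncoming_smul_iff`,
  `isOutgoing_smul_iff`, `collidePair_smul`, `freeExitTime_smul`, `incomingPairs_smul`,
  `collisionStep_smul`, `stateAfter_smul`, `collisionInstant_smul`, `collisionCount_smul`,
  `collisionCountBefore_smul`, `fwdFlow_smul`, `fwdFlowLeft_smul`, `flow_smul`,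
  `isSimpleIncoming_smul_iff`, `fwdGood_smul_iff`, `fwdGoodUpTo_smul_iff`, `configEnergy_smul`,
  `smul_mem_good_iff`.

## Mathlib / Literature reuse

The construction is `HardSphereFlowConstruction`'s, `FwdGoodUpTo` is `HardSphereFlowRestart`'s,
`reflectVel_smul` is `HardSpherePhaseSpace`'s; `real_inner_smul_left`, `apply_dite`,
`mul_right_inj'` are Mathlib's. No statement here has a Mathlib counterpart.

## References

* I. Gallagher, L. Saint-Raymond, B. Texier, *From Newton to Boltzmann: hard spheres and
  short-range potentials*, EMS (2013), arXiv:1208.5753, Ch. 4 intro, §4.1.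
* C. Cercignani, R. Illner, M. Pulvirenti, *The Mathematical Theory of Dilute Gases*, Springer
  (1994), §4.2, App. 4.A.
-/

open Set Filter Topology Function MeasureTheory
open scoped ENNReal InnerProductSpace

namespace Literature.Analysis.FluidPDE

noncomputable section

section Kinetic

variable {d : Type*} [Fintype d] {N : ℕ}

/-! ## A congruence for the pair selection in `collisionStep` -/

open Classical in
/-- The pair selection `Set.Nonempty.some` of `collisionStep` only depends on the *set* of
incoming pairs: equal sets give equal `dite`s. [folklore] -/
theorem Alexander.dite_nonempty_some_congr {α β : Type*} {s t : Set α} (h : s = t) (f : α → β)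
    (b : β) :
    (if hs : s.Nonempty then f hs.some else b) = if ht : t.Nonempty then f ht.some else b := by
  subst h; rfl

/-! ## Scaling symmetry of the Euclidean construction -/

section Scaling

/-- The reflection law is linear in the pair of velocities. [folklore] -/
theorem reflectVel_smul_pair {E : Type*} [NormedAddCommGroup E] [InnerProductSpace ℝ E]
    (n : E) (c : ℝ) (p : E × E) : reflectVel n (c • p) = c • reflectVel n p := by
  have h : ⟪c • p.1 - c • p.2, n⟫_ℝ = c * ⟪p.1 - p.2, n⟫_ℝ := by
    rw [← smul_sub, real_inner_smul_left]
  ext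
  · simp only [reflectVel, Prod.smul_fst, Prod.smul_snd, h, smul_sub, smul_smul, mul_div_assoc]
  · simp only [reflectVel, Prod.smul_fst, Prod.smul_snd, h, smul_add, smul_smul, mul_div_assoc]

namespace Alexander

variable {c : ℝ}

omit [Fintype d] in
/-- Positions of a rescaled configuration. [folklore] -/
theorem smul_config_fst (c : ℝ) (z : Config N d (EuclideanSpace ℝ d)) (i : Fin N) :
    ((c • z) i).1 = c • (z i).1 := rfl

omit [Fintype d] in
/-- Velocities of a rescaled configuration. [folklore] -/
theorem smul_config_snd (c : ℝ) (z : Config N d (EuclideanSpace ℝ d)) (i : Fin N) :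
    ((c • z) i).2 = c • (z i).2 := rfl

/-- Free flight commutes with the rescaling `z ↦ c • z` of positions and velocities (time is
not rescaled). [folklore] -/
theorem freeFlight_smul (c t : ℝ) (z : Config N d (EuclideanSpace ℝ d)) :
    freeFlight (Euclidean.geometry d) t (c • z) = c • freeFlight (Euclidean.geometry d) t z := by
  funext i
  simp only [freeFlight_apply, Euclidean.geometry_translate, Pi.smul_apply, Prod.smul_fst,
    Prod.smul_snd, Prod.smul_mk, smul_add, smul_smul, mul_comm t c]

omit [Fintype d] in
/-- The velocity flip commutes with rescaling. [folklore] -/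
theorem flipVel_smul (c : ℝ) (z : Config N d (EuclideanSpace ℝ d)) :
    flipVel (c • z) = c • flipVel z := by
  funext i
  simp only [flipVel_apply, Pi.smul_apply, Prod.smul_fst, Prod.smul_snd, Prod.smul_mk, smul_neg]

/-- Separation vectors of a rescaled configuration. [folklore] -/
theorem sepVec_smul (c : ℝ) (z : Config N d (EuclideanSpace ℝ d)) (i j : Fin N) :
    (Euclidean.geometry d).sepVec ((c • z) i).1 ((c • z) j).1 =
      c • (Euclidean.geometry d).sepVec (z i).1 (z j).1 := by
  simp only [Euclidean.geometry_sepVec, smul_config_fst, smul_sub]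

/-- Rescaling by `c > 0` maps the hard-sphere domain of diameter `ε` onto that of diameter
`c ε`. [folklore] -/
theorem smul_mem_hardSphereDomain_iff (hc : 0 < c) {ε : ℝ} {z : Config N d (EuclideanSpace ℝ d)} :
    c • z ∈ hardSphereDomain (Euclidean.geometry d) N (c * ε) ↔
      z ∈ hardSphereDomain (Euclidean.geometry d) N ε := by
  simp only [mem_hardSphereDomain, sepVec_smul, norm_smul, Real.norm_eq_abs, abs_of_pos hc]
  refine forall₃_congr fun i j _ => ⟨fun h => le_of_mul_le_mul_left h hc, fun h => ?_⟩
  exact mul_le_mul_of_nonneg_left h hc.le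

/-- Rescaling by `c > 0` maps contact sets to contact sets. [folklore] -/
theorem smul_mem_contactSet_iff (hc : 0 < c) {ε : ℝ} {i j : Fin N}
    {z : Config N d (EuclideanSpace ℝ d)} :
    c • z ∈ contactSet (Euclidean.geometry d) N (c * ε) i j ↔
      z ∈ contactSet (Euclidean.geometry d) N ε i j := by
  rw [mem_contactSet, mem_contactSet, smul_mem_hardSphereDomain_iff hc, sepVec_smul, norm_smul,
    Real.norm_eq_abs, abs_of_pos hc, mul_right_inj' hc.ne']

/-- The normal relative velocity of a pair scales by `c²`. [folklore] -/
theorem inner_sepVec_smul (c : ℝ) (z : Config N d (EuclideanSpace ℝ d)) (i j : Fin N) :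
    ⟪(Euclidean.geometry d).sepVec ((c • z) i).1 ((c • z) j).1, ((c • z) i).2 - ((c • z) j).2⟫_ℝ =
      c * c * ⟪(Euclidean.geometry d).sepVec (z i).1 (z j).1, (z i).2 - (z j).2⟫_ℝ := by
  rw [sepVec_smul, smul_config_snd, smul_config_snd, ← smul_sub, inner_smul_left, inner_smul_right]
  simp only [RCLike.conj_to_real]
  ring

/-- Rescaling by `c ≠ 0` preserves incoming pairs. [folklore] -/
theorem isIncoming_smul_iff (hc : c ≠ 0) {z : Config N d (EuclideanSpace ℝ d)} {i j : Fin N} :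
    IsIncoming (Euclidean.geometry d) (c • z) i j ↔ IsIncoming (Euclidean.geometry d) z i j := by
  have hcc : 0 < c * c := mul_self_pos.2 hc
  rw [IsIncoming, IsIncoming, inner_sepVec_smul]
  constructor <;> intro h <;> nlinarith

/-- Rescaling by `c ≠ 0` preserves outgoing pairs. [folklore] -/
theorem isOutgoing_smul_iff (hc : c ≠ 0) {z : Config N d (EuclideanSpace ℝ d)} {i j : Fin N} :
    IsOutgoing (Euclidean.geometry d) (c • z) i j ↔ IsOutgoing (Euclidean.geometry d) z i j := by
  have hcc : 0 < c * c := mul_self_pos.2 hc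
  rw [IsOutgoing, IsOutgoing, inner_sepVec_smul]
  constructor <;> intro h <;> nlinarith

/-- The elastic collision of a pair commutes with rescaling by `c ≠ 0` (the reflection law is
linear in the velocities and only depends on the line of the impact direction). [folklore] -/
theorem collidePair_smul (hc : c ≠ 0) (i j : Fin N) (z : Config N d (EuclideanSpace ℝ d)) :
    collidePair (Euclidean.geometry d) i j (c • z) = c • collidePair (Euclidean.geometry d) i j z := by
  have hR : reflectVel ((Euclidean.geometry d).sepVec ((c • z) i).1 ((c • z) j).1)
      (((c • z) i).2, ((c • z) j).2) =
        c • reflectVel ((Euclidean.geometry d).sepVec (z i).1 (z j).1) ((z i).2, (z j).2) := by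
    rw [sepVec_smul, reflectVel_smul hc, smul_config_snd, smul_config_snd, ← Prod.smul_mk,
      reflectVel_smul_pair]
  funext k
  rw [Pi.smul_apply]
  by_cases hkj : k = j
  · subst hkj
    rw [collidePair_apply_right, collidePair_apply_right, hR]
    rfl
  by_cases hki : k = i
  · subst hki
    rw [collidePair_apply_left hkj, collidePair_apply_left hkj, hR]
    rfl
  rw [collidePair_apply_of_ne hki hkj, collidePair_apply_of_ne hki hkj]
  rfl

/-- The exit time is invariant under rescaling: `τ_{cε}(c z) = τ_ε(z)` for `c > 0`. [folklore] -/
theorem freeExitTime_smul (hc : 0 < c) (ε : ℝ) (z : Config N d (EuclideanSpace ℝ d)) :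
    freeExitTime (Euclidean.geometry d) (c * ε) (c • z) = freeExitTime (Euclidean.geometry d) ε z := by
  unfold freeExitTime
  simp only [freeFlight_smul, smul_mem_hardSphereDomain_iff hc]

/-- The incoming contact pairs are invariant under rescaling by `c > 0`. [folklore] -/
theorem incomingPairs_smul (hc : 0 < c) (ε : ℝ) (z : Config N d (EuclideanSpace ℝ d)) :
    incomingPairs (Euclidean.geometry d) (c * ε) (c • z) = incomingPairs (Euclidean.geometry d) ε z := by
  ext p
  simp only [mem_incomingPairs, smul_mem_contactSet_iff hc, isIncoming_smul_iff hc.ne']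

/-- The collision step commutes with rescaling by `c > 0`. [folklore] -/
theorem collisionStep_smul (hc : 0 < c) (ε : ℝ) (z : Config N d (EuclideanSpace ℝ d)) :
    collisionStep (Euclidean.geometry d) (c * ε) (c • z) =
      c • collisionStep (Euclidean.geometry d) ε z := by
  by_cases hτ : freeExitTime (Euclidean.geometry d) ε z = ∞
  · rw [collisionStep_of_eq_top (by rwa [freeExitTime_smul hc]), collisionStep_of_eq_top hτ]
  · rw [collisionStep, if_neg (by rwa [freeExitTime_smul hc]), collisionStep, if_neg hτ]
    dsimp only
    rw [freeExitTime_smul hc, freeFlight_smul, apply_dite (fun w : Config N d (EuclideanSpace ℝ d) => c • w)]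
    simp_rw [collidePair_smul hc.ne']
    exact dite_nonempty_some_congr (incomingPairs_smul hc ε _)
      (fun p => c • collidePair (Euclidean.geometry d) p.1 p.2 _) _

/-- The post-collisional states commute with rescaling by `c > 0`. [folklore] -/
theorem stateAfter_smul (hc : 0 < c) (ε : ℝ) (z : Config N d (EuclideanSpace ℝ d)) (k : ℕ) :
    stateAfter (Euclidean.geometry d) (c * ε) (c • z) k = c • stateAfter (Euclidean.geometry d) ε z k := by
  induction k with
  | zero => rfl
  | succ k ih => rw [stateAfter_succ, stateAfter_succ, ih, collisionStep_smul hc]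

/-- The collision instants are invariant under rescaling by `c > 0`. [folklore] -/
theorem collisionInstant_smul (hc : 0 < c) (ε : ℝ) (z : Config N d (EuclideanSpace ℝ d)) (k : ℕ) :
    collisionInstant (Euclidean.geometry d) (c * ε) (c • z) k =
      collisionInstant (Euclidean.geometry d) ε z k := by
  unfold collisionInstant
  exact Finset.sum_congr rfl fun m _ => by rw [stateAfter_smul hc, freeExitTime_smul hc]

/-- The collision counts are invariant under rescaling by `c > 0`. [folklore] -/
theorem collisionCount_smul (hc : 0 < c) (ε : ℝ) (z : Config N d (EuclideanSpace ℝ d)) (t : ℝ) :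
    collisionCount (Euclidean.geometry d) (c * ε) (c • z) t =
      collisionCount (Euclidean.geometry d) ε z t := by
  unfold collisionCount
  simp only [collisionInstant_smul hc]

/-- The strict collision counts are invariant under rescaling by `c > 0`. [folklore] -/
theorem collisionCountBefore_smul (hc : 0 < c) (ε : ℝ) (z : Config N d (EuclideanSpace ℝ d)) (t : ℝ) :
    collisionCountBefore (Euclidean.geometry d) (c * ε) (c • z) t =
      collisionCountBefore (Euclidean.geometry d) ε z t := by
  unfold collisionCountBefore
  simp only [collisionInstant_smul hc]

/-- The forward flow commutes with rescaling by `c > 0`. [folklore] -/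
theorem fwdFlow_smul (hc : 0 < c) (ε : ℝ) (z : Config N d (EuclideanSpace ℝ d)) (t : ℝ) :
    fwdFlow (Euclidean.geometry d) (c * ε) (c • z) t = c • fwdFlow (Euclidean.geometry d) ε z t := by
  rw [fwdFlow, fwdFlow, collisionCount_smul hc, collisionInstant_smul hc, stateAfter_smul hc,
    freeFlight_smul]

/-- The left-continuous forward flow commutes with rescaling by `c > 0`. [folklore] -/
theorem fwdFlowLeft_smul (hc : 0 < c) (ε : ℝ) (z : Config N d (EuclideanSpace ℝ d)) (t : ℝ) :
    fwdFlowLeft (Euclidean.geometry d) (c * ε) (c • z) t =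
      c • fwdFlowLeft (Euclidean.geometry d) ε z t := by
  rw [fwdFlowLeft, fwdFlowLeft, collisionCountBefore_smul hc, collisionInstant_smul hc,
    stateAfter_smul hc, freeFlight_smul]

/-- **Scaling symmetry of the Euclidean collision-by-collision flow**: `T^t_{cε}(c z) = c T^t_ε(z)`
for `c > 0` (positions, velocities and the diameter are rescaled, time is not). [folklore] -/
theorem flow_smul (hc : 0 < c) (ε t : ℝ) (z : Config N d (EuclideanSpace ℝ d)) :
    flow (Euclidean.geometry d) (c * ε) t (c • z) = c • flow (Euclidean.geometry d) ε t z := by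
  unfold flow
  split_ifs
  · exact fwdFlow_smul hc ε z t
  · rw [flipVel_smul, fwdFlowLeft_smul hc, flipVel_smul]

/-- Simple incoming collision configurations are invariant under rescaling by `c > 0`. [folklore] -/
theorem isSimpleIncoming_smul_iff (hc : 0 < c) {ε : ℝ} {z : Config N d (EuclideanSpace ℝ d)} :
    IsSimpleIncoming (Euclidean.geometry d) (c * ε) (c • z) ↔
      IsSimpleIncoming (Euclidean.geometry d) ε z := by
  simp only [IsSimpleIncoming, isIncoming_smul_iff hc.ne', smul_mem_contactSet_iff hc]

/-- Forward regularity is invariant under rescaling by `c > 0`. [folklore] -/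
theorem fwdGood_smul_iff (hc : 0 < c) {ε : ℝ} {z : Config N d (EuclideanSpace ℝ d)} :
    FwdGood (Euclidean.geometry d) (c * ε) (c • z) ↔ FwdGood (Euclidean.geometry d) ε z := by
  simp only [FwdGood, stateAfter_smul hc, freeExitTime_smul hc, freeFlight_smul,
    isSimpleIncoming_smul_iff hc, smul_mem_contactSet_iff hc]

/-- Truncated forward regularity is invariant under rescaling by `c > 0`. [folklore] -/
theorem fwdGoodUpTo_smul_iff (hc : 0 < c) {ε T : ℝ} {z : Config N d (EuclideanSpace ℝ d)} :
    FwdGoodUpTo (Euclidean.geometry d) (c * ε) T (c • z) ↔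
      FwdGoodUpTo (Euclidean.geometry d) ε T z := by
  simp only [FwdGoodUpTo, stateAfter_smul hc, freeExitTime_smul hc, freeFlight_smul,
    isSimpleIncoming_smul_iff hc, smul_mem_contactSet_iff hc, collisionInstant_smul hc]

/-- The kinetic energy of a rescaled configuration. [folklore] -/
theorem configEnergy_smul (c : ℝ) (z : Config N d (EuclideanSpace ℝ d)) :
    configEnergy (c • z) = c ^ 2 * configEnergy z := by
  simp only [configEnergy, smul_config_snd, norm_smul, Real.norm_eq_abs, mul_pow, sq_abs,
    Finset.mul_sum]
  ring

/-- **The good set is invariant under rescaling**: `c z ∈ Γ₀(cε) ↔ z ∈ Γ₀(ε)` for `c > 0`. [folklore] -/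
theorem smul_mem_good_iff (hc : 0 < c) {ε : ℝ} {z : Config N d (EuclideanSpace ℝ d)} :
    c • z ∈ good (Euclidean.geometry d) (c * ε) ↔ z ∈ good (Euclidean.geometry d) ε := by
  simp only [good, mem_setOf_eq, smul_mem_hardSphereDomain_iff hc, smul_mem_contactSet_iff hc,
    isOutgoing_smul_iff hc.ne', fwdGood_smul_iff hc, flipVel_smul]

end Alexander

end Scaling

end Kinetic

end

end Literature.Analysis.FluidPDE
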